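import Summits.Ventures.PercRepro.SeriesParallelPendantC005
import Summits.Ventures.PercRepro.ReducedC005

/-!
# C-005 reduces to networks whose unmarked vertices have live degree at least three

`ReducedC005.lean` removes live parallel pairs and unmarked vertices of live degree two. This file
adds the vertices of live degree one: a **live pendant vertex** (`IsPendantLive`) is an unmarked
vertex `x` with exactly one live edge `e`, to `w ≠ x`. Parking the dead edges at `x`
(`parkDead`) makes `x` a pendant vertex in p5's sense (`IsPendantLive.pendant_parkDead`), so the
edge `e` may be killed (`prob_partitionEvent_update_zero_of_pendant'`,
`SeriesParallelPendantC005.lean`): `IsPendantLive.prob_partitionEvent`, `C005At_of_isPendantLive`.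

`IsReducedP`: no live parallel pair, and every live series or live pendant vertex is a mark — every
unmarked vertex has live degree `0` or `≥ 3`. **`C005_iff_C005ReducedP`**: the conjecture of record
is equivalent to C-005 on these instances.
-/

namespace PercRepro

namespace MultiGraph

open Finset

variable {V E : Type}

/-- **A live pendant vertex**: the only live edge at `x` is `e`, joining `x` and `w ≠ x`; dead
edges at `x` are allowed. -/
structure IsPendantLive (G : MultiGraph V E) (p : E → ℝ) (e : E) (x w : V) : Prop where
  live : p e ≠ 0
  ends : (G.fst e = x ∧ G.snd e = w) ∨ (G.fst e = w ∧ G.snd e = x)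
  wx : w ≠ x
  deg : ∀ e', p e' ≠ 0 → G.fst e' = x ∨ G.snd e' = x → e' = e

/-- After parking the dead edges, a live pendant vertex is a pendant vertex (p5's `Pendant`). -/
theorem IsPendantLive.pendant_parkDead {G : MultiGraph V E} {p : E → ℝ} {e : E} {x w : V}
    (h : G.IsPendantLive p e x w) : (G.parkDead p x w).Pendant x w := by
  have he := parkDead_agree_live G p x w e h.live
  constructor
  · intro e' he'
    rw [mem_edgesAt, Set.mem_singleton_iff, Set.mem_singleton_iff] at he'
    by_cases hd : p e' = 0 ∧ (G.fst e' = x ∨ G.snd e' = x)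
    · exfalso
      have hf : (G.parkDead p x w).fst e' = w := by simp [parkDead, hd]
      have hs : (G.parkDead p x w).snd e' = w := by simp [parkDead, hd]
      rw [hf, hs] at he'
      rcases he' with he' | he' <;> exact h.wx he'
    · have hf : (G.parkDead p x w).fst e' = G.fst e' := by simp [parkDead, hd]
      have hs : (G.parkDead p x w).snd e' = G.snd e' := by simp [parkDead, hd]
      rw [hf, hs] at he'
      by_cases hp : p e' = 0
      · exact absurd ⟨hp, he'⟩ hd
      · obtain rfl := h.deg e' hp he'
        rw [hf, hs]
        exact h.ends
  · refine ⟨e, ?_⟩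
    rw [mem_edgesAt, Set.mem_singleton_iff, Set.mem_singleton_iff, ← he.1, ← he.2]
    rcases h.ends with ⟨h1, -⟩ | ⟨-, h2⟩
    · exact Or.inl h1
    · exact Or.inr h2

/-- The live edge of a live pendant vertex is at that vertex in the parked graph. -/
theorem IsPendantLive.mem_edgesAt_parkDead {G : MultiGraph V E} {p : E → ℝ} {e : E} {x w : V}
    (h : G.IsPendantLive p e x w) : e ∈ (G.parkDead p x w).edgesAt ({x} : Set V) := by
  have he := parkDead_agree_live G p x w e h.live
  rw [mem_edgesAt, Set.mem_singleton_iff, Set.mem_singleton_iff, ← he.1, ← he.2]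
  rcases h.ends with ⟨h1, -⟩ | ⟨-, h2⟩
  · exact Or.inl h1
  · exact Or.inr h2

variable [Fintype E] [DecidableEq E]

/-- **The live edge of a live pendant vertex may be killed**: for marks avoiding `x`, the
partition probabilities of `(G, p)` are those of the parked graph with `e` dead. -/
theorem IsPendantLive.prob_partitionEvent {G : MultiGraph V E} {p : E → ℝ} {e : E} {x w : V}
    (h : G.IsPendantLive p e x w) {k : ℕ} {m : Fin k → V} (hm : ∀ i, m i ≠ x) (rgs : Fin k → ℕ) :
    prob p (G.partitionEvent m rgs) =
      prob (Function.update p e 0) ((G.parkDead p x w).partitionEvent m rgs) := by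
  rw [prob_partitionEvent_congr_of_live p (parkDead_agree_live G p x w) m rgs]
  exact prob_partitionEvent_update_zero_of_pendant' h.pendant_parkDead h.wx.symm
    h.mem_edgesAt_parkDead p hm rgs

/-- **C-005 transports backwards through a live pendant vertex.** -/
theorem C005At_of_isPendantLive {G : MultiGraph V E} {p : E → ℝ} {e : E} {x w : V}
    (h : G.IsPendantLive p e x w) {a b c d : V} (hx : x ≠ a ∧ x ≠ b ∧ x ≠ c ∧ x ≠ d)
    (hC : (G.parkDead p x w).C005At (Function.update p e 0) a b c d) : G.C005At p a b c d := by
  unfold C005At at hC ⊢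
  have hm := marks_ne_of_ne hx
  rw [h.prob_partitionEvent hm ![0, 0, 1, 1], h.prob_partitionEvent hm ![0, 1, 0, 1],
    h.prob_partitionEvent hm ![0, 1, 1, 0], h.prob_partitionEvent hm ![0, 0, 0, 0],
    h.prob_partitionEvent hm ![0, 1, 2, 3]]
  exact hC

/-- Killing a live edge strictly shrinks the live edges. -/
theorem liveEdges_update_zero_ssubset {p : E → ℝ} {e : E} (he : p e ≠ 0) :
    liveEdges (Function.update p e 0) ⊂ liveEdges p := by
  rw [Finset.ssubset_iff_of_subset]
  · refine ⟨e, mem_liveEdges.2 he, ?_⟩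
    rw [mem_liveEdges, Function.update_self]
    exact fun h => h rfl
  · intro x hx
    rw [mem_liveEdges] at hx ⊢
    by_cases hxe : x = e
    · subst hxe
      rw [Function.update_self] at hx
      exact absurd rfl hx
    · rwa [Function.update_of_ne hxe] at hx

omit [Fintype E] in
/-- A probability vector with one edge killed is a probability vector. -/
theorem isProb_update_zero {p : E → ℝ} (hp : IsProb p) (e : E) :
    IsProb (Function.update p e 0) :=
  hp.update e ⟨le_rfl, zero_le_one⟩

/-- **A fully reduced instance**: no live parallel pair, and every live series vertex and every
live pendant vertex is a mark — every unmarked vertex has live degree `0` or at least `3`. -/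
def IsReducedP (G : MultiGraph V E) (p : E → ℝ) (a b c d : V) : Prop :=
  G.IsReduced p a b c d ∧ ∀ e x w, G.IsPendantLive p e x w → x = a ∨ x = b ∨ x = c ∨ x = d

/-- **C-005 on the fully reduced instances of an edge type gives C-005 on every instance.** -/
theorem C005At_of_forall_isReducedP {a b c d : V}
    (hred : ∀ (G : MultiGraph V E) (p : E → ℝ), IsProb p → G.IsReducedP p a b c d →
      G.C005At p a b c d)
    (G : MultiGraph V E) (p : E → ℝ) (hp : IsProb p) : G.C005At p a b c d := by
  suffices key : ∀ n : ℕ, ∀ (G : MultiGraph V E) (q : E → ℝ), IsProb q → (liveEdges q).card = n →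
      G.C005At q a b c d from key _ G p hp rfl
  intro n
  induction n using Nat.strong_induction_on with
  | _ n ih =>
    intro G q hq hcard
    by_cases hr : G.IsReducedP q a b c d
    · exact hred G q hq hr
    · unfold IsReducedP IsReduced at hr
      rw [not_and_or, not_and_or] at hr
      rcases hr with (hpar | hser) | hpen
      · simp only [not_forall, not_not] at hpar
        obtain ⟨e₁, e₂, hne, h₁, h₂, hpar⟩ := hpar
        have hlt : (liveEdges (parWeight q e₁ e₂)).card < n := by
          rw [← hcard]
          exact card_lt_card (liveEdges_parWeight_ssubset hne h₁ h₂)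
        exact C005At_of_step (SPStep.parallel hne hpar)
          (ih _ hlt G _ (isProb_parWeight hq e₁ e₂) rfl)
      · simp only [not_forall] at hser
        obtain ⟨e₁, e₂, x, y, z, hs, hx⟩ := hser
        simp only [not_or] at hx
        have hlt : (liveEdges (serWeight q e₁ e₂)).card < n := by
          rw [← hcard]
          exact card_lt_card (liveEdges_serWeight_ssubset hs.ne hs.live₁ hs.live₂)
        exact C005At_of_isSeriesLive hs hx
          (ih _ hlt _ _ (isProb_serWeight hq e₁ e₂) rfl)
      · simp only [not_forall] at hpen
        obtain ⟨e, x, w, hpe, hx⟩ := hpen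
        simp only [not_or] at hx
        have hlt : (liveEdges (Function.update q e 0)).card < n := by
          rw [← hcard]
          exact card_lt_card (liveEdges_update_zero_ssubset hpe.live)
        exact C005At_of_isPendantLive hpe hx
          (ih _ hlt _ _ (isProb_update_zero hq e) rfl)

/-- **C-005 on fully reduced instances.** -/
def C005ReducedP : Prop :=
  ∀ {V E : Type} [Fintype E] [DecidableEq E] (G : MultiGraph V E) (p : E → ℝ), IsProb p →
    ∀ a b c d : V, G.IsReducedP p a b c d → G.C005At p a b c d

/-- **WLOG fully reduced**: C-005 on the instances in which every unmarked vertex has live degree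
`0` or `≥ 3` and no two live edges are parallel is C-005. -/
theorem C005_of_C005ReducedP (h : C005ReducedP) : C005 := by
  intro V E _ _ G p hp a b c d
  exact C005At_of_forall_isReducedP (fun G p hp hr => h G p hp a b c d hr) G p hp

/-- C-005 on fully reduced instances follows from C-005. -/
theorem C005ReducedP_of_C005 (h : C005) : C005ReducedP := by
  intro V E _ _ G p hp a b c d _
  exact h G p hp a b c d

/-- **C-005 is equivalent to its fully reduced form.** -/
theorem C005_iff_C005ReducedP : C005 ↔ C005ReducedP :=
  ⟨C005ReducedP_of_C005, C005_of_C005ReducedP⟩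

end MultiGraph

end PercRepro
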